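import Mathlib
import Literature.AlgebraicGeometry.Ramification.InertiaNormalSylow
import Literature.AlgebraicGeometry.Ramification.NormalSylowExtensions
import Summits.ResolutionOfSingularities.ResolutionOfSingularities.Theorems.WildQuotientsWildQuotientResolutionFlagPieces
import Summits.ResolutionOfSingularities.ResolutionOfSingularities.Theorems.WildQuotientsWildQuotientResolutionFlagStepFacts
import HarnessLib

/-!
# Flags with p-closed piece QUOTIENTS (crux `WildQuotients.WildQuotientResolution`, Phase 0, any embedding dimension)

Crux stmt-ResolutionOfSingularities-15640 (`WildQuotientResolution`), line `Sketch` (card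
`p-closure-sylow-separation`), registered stub `stub_phaseZeroHighDim`. The intrinsic form of
`FlagPieces.hasNormalSylow_of_flag_pieces` (`Theorems/…FlagPieces.lean`): instead of auxiliary
homomorphisms `f i : I → A i` to p-closed groups, the pieces `K (i+1) / K i` of a `τ`-stable flag
come with their KERNELS `N i = {g | (τ g - 1) K (i+1) ⊆ K i}` — normal subgroups by
`FlagStepFacts.exists_pieceKernel` — and the hypothesis is that each quotient `I / N i` (the
faithful image of the inertia on the piece) is p-closed. This is the statement an induction on the
embedding dimension quotes: "the inertia acts on every graded piece of the flag through a p-closed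
group".

* `hasNormalSylow_of_flag_kernels` — the theorem.
* `hasNormalSylow_of_stable_flag` — the same with the kernels produced from `τ`-stable ideals
  (`exists_pieceKernel`), hypothesis stated on the quotients by the piece kernels.

[OURS · crux stmt-ResolutionOfSingularities-15640 · helper toward `stub_phaseZeroHighDim`; folklore
group theory / local algebra, counted 0; AI-level work, weaker than expert review.]
-/

-- single-problem summit: the doubled namespace component `ResolutionOfSingularities` is forced
set_option linter.dupNamespace false

open IsLocalRing Literature.AlgebraicGeometry.Ramification
open Summit.ResolutionOfSingularities.ResolutionOfSingularities.Theorems.WildQuotientResolution.FlagPieces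
open Summit.ResolutionOfSingularities.ResolutionOfSingularities.Theorems.WildQuotientResolution.FlagStepFacts

namespace Summit.ResolutionOfSingularities.ResolutionOfSingularities.Theorems.WildQuotientResolution.FlagKernels

variable {R : Type*} [CommRing R] [IsLocalRing R] {I : Type*} [Group I]

/-- **Flag with p-closed piece quotients ⟹ p-closed.** Let `(R, 𝔪, κ)` be a Noetherian local ring
of residue characteristic `p`, `τ` a faithful residue-trivial action of the finite group `I`,
`K : ℕ → Ideal R` with `K 0 ≤ 𝔪²`, `𝔪 ≤ K n`, and `N : ℕ → Subgroup I` normal subgroups such that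
for `i < n` every `g ∈ N i` moves `K (i+1)` inside `K i` and `I / N i` has a normal Sylow
`p`-subgroup. Then `I` has a normal Sylow `p`-subgroup (`FlagPieces.hasNormalSylow_of_flag_pieces`
with `f i = QuotientGroup.mk' (N i)`). [folklore] -/
theorem hasNormalSylow_of_flag_kernels (p : ℕ) [Fact p.Prime] [IsNoetherianRing R]
    [CharP (ResidueField R) p] [Finite I] {τ : I →* (R ≃+* R)} (hτ : Function.Injective τ)
    (hres : ∀ (g : I) (r : R), τ g r - r ∈ maximalIdeal R)
    (n : ℕ) (K : ℕ → Ideal R) (hK0 : K 0 ≤ maximalIdeal R ^ 2) (hKn : maximalIdeal R ≤ K n)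
    (N : ℕ → Subgroup I) [hN : ∀ i, (N i).Normal]
    (hNp : ∀ i < n, HasNormalSylow p (I ⧸ N i))
    (hNK : ∀ i < n, ∀ g ∈ N i, ∀ r ∈ K (i + 1), τ g r - r ∈ K i) :
    HasNormalSylow p I :=
  hasNormalSylow_of_flag_pieces p hτ hres n K hK0 hKn (A := fun i => I ⧸ N i) hNp
    (fun i => QuotientGroup.mk' (N i)) fun i hi g hg =>
      hNK i hi g ((QuotientGroup.eq_one_iff g).mp hg)

/-- **Stable flag whose piece kernels have p-closed quotients ⟹ p-closed.** Let `(R, 𝔪, κ)` be a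
Noetherian local ring of residue characteristic `p`, `τ` a faithful residue-trivial action of the
finite group `I`, and `K : ℕ → Ideal R` a chain of `τ`-STABLE ideals with `K 0 ≤ 𝔪²`, `𝔪 ≤ K n`.
Suppose that for each `i < n` and each normal subgroup `M` which is exactly the kernel of the piece
`K (i+1) / K i` (`g ∈ M ↔ (τ g - 1) K (i+1) ⊆ K i`; such `M` exists by
`FlagStepFacts.exists_pieceKernel`) the quotient `I / M` has a normal Sylow `p`-subgroup. Then `I`
has a normal Sylow `p`-subgroup. [folklore] -/
theorem hasNormalSylow_of_stable_flag (p : ℕ) [Fact p.Prime] [IsNoetherianRing R]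
    [CharP (ResidueField R) p] [Finite I] {τ : I →* (R ≃+* R)} (hτ : Function.Injective τ)
    (hres : ∀ (g : I) (r : R), τ g r - r ∈ maximalIdeal R)
    (n : ℕ) (K : ℕ → Ideal R) (hK0 : K 0 ≤ maximalIdeal R ^ 2) (hKn : maximalIdeal R ≤ K n)
    (hKτ : ∀ (g : I) (i : ℕ), ∀ x ∈ K i, τ g x ∈ K i)
    (hq : ∀ i < n, ∀ (M : Subgroup I) [M.Normal],
      (∀ g, g ∈ M ↔ ∀ r ∈ K (i + 1), τ g r - r ∈ K i) → HasNormalSylow p (I ⧸ M)) :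
    HasNormalSylow p I := by
  have hex : ∀ i : ℕ, ∃ M : Subgroup I, M.Normal ∧ ∀ g, g ∈ M ↔ ∀ r ∈ K (i + 1), τ g r - r ∈ K i :=
    fun i => exists_pieceKernel τ (K i) (K (i + 1)) (fun g x hx => hKτ g i x hx)
      (fun g x hx => hKτ g (i + 1) x hx)
  choose N hNn hNmem using hex
  haveI : ∀ i, (N i).Normal := hNn
  exact hasNormalSylow_of_flag_kernels p hτ hres n K hK0 hKn N
    (fun i hi => hq i hi (N i) (hNmem i)) fun i _ g hg => (hNmem i g).mp hg

end Summit.ResolutionOfSingularities.ResolutionOfSingularities.Theorems.WildQuotientResolution.FlagKernels
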